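/-
Copyright (c) 2026. All rights reserved.
Released under Apache 2.0 license as described in the file LICENSE.
Authors: abc-iut cell, prover seat abc-iut-L4-d1 (gen 8; row «HYP⇒NONAB@FINITE-TYPE», F1: Liouville's theorem on a
Riemann surface of finite type).
-/
import Literature.AnabelianGeometry.AbsoluteAnabelian.HolomorphicCoresDeckProofs
import Literature.Geometry.Kaehler.RiemannSphereLiouville
import HarnessLib

/-!
# Bounded holomorphic functions on a Riemann surface of finite type are constant (PROOF-ONLY)

H. M. Farkas, I. Kra, *Riemann Surfaces*, 2nd ed. (1992), IV.4 / Prop. IV.6.? («a compact surface with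
finitely many punctures is parabolic … carries no non-constant bounded holomorphic function»); W. Schlag,
*A Course in Complex Analysis and Riemann Surfaces* (2014), §4.3 p.129 (the «topological proof» of
Liouville's theorem: a bounded holomorphic function has removable singularities at the punctures and is
therefore a holomorphic function on a compact surface, hence constant).  In S. Mochizuki, *Topics in Absolute
Anabelian Geometry III*, Cor. 2.4 p.54 / Def. 4.1 (i) p.101, the Riemann surfaces in play are «hyperbolic
Riemann surfaces OF FINITE TYPE», i.e. compact surfaces minus finitely many points (the tree's
`IsOfFiniteType`: a biholomorphism `X ≅ X̄ ∖ S`, `X̄` compact connected, `S` finite).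

* ★ `exists_eq_const_of_isOfFiniteType_of_bounded` — **Liouville at finite type**: for `X` of finite type,
  every bounded holomorphic `g : X → ℂ` is constant.  Proof: transport `g` to `X̄ ∖ S`, extend over each of the
  finitely many punctures by the bounded removable-singularity theorem on a Riemann surface
  (`RiemannSurface.mdifferentiableAt_update_limUnder`, Schlag §4.3), and apply Mathlib's
  `MDifferentiable.exists_eq_const_of_compactSpace` on the compact connected `X̄`.
* `norm_lt_of_isOfFiniteType_of_norm_lt` / `not_exists_…` — convenient negative forms («no non-constant
  holomorphic map into a disc»).

This is the analytic input of abc-iut-L4-d1's «a NON-COMPACT finite-type Riemann surface uniformised by `ℍ`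
has non-abelian `π₁`» (files `…PSLCyclicParabolicDeckBounded`, `…PSLPuncturedGenuineHyperbolic`).
PROOF-ONLY (no definition, no instance, no named fact); classical; MODEL side of [AbsTopIII] §2/§4; nothing
here bears on the disputed [IUTchIII] Cor. 3.12.

## References
* H. M. Farkas, I. Kra, *Riemann Surfaces*, GTM 71, 2nd ed. (1992), IV.4. [FarkasKra1992]
* W. Schlag, *A Course in Complex Analysis and Riemann Surfaces*, GSM 154 (2014), §4.3. [Schlag2014]
* S. Mochizuki, *Topics in Absolute Anabelian Geometry III* (2015), Cor. 2.4 p.54. [MochizukiAbsTopIII2015]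
-/

set_option autoImplicit false

noncomputable section

open scoped _root_.Manifold _root_.ContDiff _root_.Topology
open _root_.Set _root_.Filter _root_.Function _root_.TopologicalSpace
open Literature.Geometry.Kaehler

namespace Literature.AnabelianGeometry.AbsoluteAnabelian

universe u

/-- Off a finite subset of a `T1` space, a punctured neighbourhood of any point avoids the subset.
[folklore] -/
private theorem eventually_nhdsNE_notMem_of_finite {M : Type u} [TopologicalSpace M] [T1Space M]
    {S : Set M} (hS : S.Finite) (x : M) : ∀ᶠ q in 𝓝[≠] x, q ∉ S := by
  have h : ∀ᶠ q in 𝓝[≠] x, q ∈ (S ∩ {x}ᶜ)ᶜ :=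
    mem_nhdsWithin_of_mem_nhds ((hS.subset inter_subset_left).isClosed.isOpen_compl.mem_nhds (by simp))
  filter_upwards [h, self_mem_nhdsWithin] with q hq hqx
  exact fun hqS => hq ⟨hqS, hqx⟩

/-- **Removable singularities at finitely many points, bounded form.**  On a Riemann surface `M`, a function
`G₀` holomorphic off a finite set `S` and bounded has a holomorphic modification `G` agreeing with `G₀` off
`S` (at `p ∈ S` the value is the limit `limUnder (𝓝[≠] p) G₀`). [cite: Schlag2014, §4.3 (p. 129)] -/
theorem exists_mdifferentiable_eqOn_compl_of_finite_of_bounded {M : Type u} [TopologicalSpace M]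
    [T2Space M] [ChartedSpace ℂ M] [IsManifold 𝓘(ℂ, ℂ) ω M] {S : Set M} (hS : S.Finite) {G₀ : M → ℂ}
    (hG₀ : ∀ x ∉ S, MDifferentiableAt 𝓘(ℂ, ℂ) 𝓘(ℂ, ℂ) G₀ x) {C : ℝ} (hb : ∀ x, ‖G₀ x‖ ≤ C) :
    ∃ G : M → ℂ, MDifferentiable 𝓘(ℂ, ℂ) 𝓘(ℂ, ℂ) G ∧ ∀ x ∉ S, G x = G₀ x := by
  classical
  -- the modification: at the points of `S` take the punctured limit
  refine ⟨fun x => if x ∈ S then limUnder (𝓝[≠] x) G₀ else G₀ x, fun p => ?_,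
    fun x hx => by simp only [hx, if_false]⟩
  -- `G₀` is holomorphic and bounded on a punctured neighbourhood of every point
  have hd : ∀ p, ∀ᶠ x in 𝓝[≠] p, MDifferentiableAt 𝓘(ℂ, ℂ) 𝓘(ℂ, ℂ) G₀ x := fun p => by
    filter_upwards [eventually_nhdsNE_notMem_of_finite hS p] with x hx using hG₀ x hx
  have hbd : ∀ p, IsBoundedUnder (· ≤ ·) (𝓝[≠] p) fun x => ‖G₀ x‖ := fun p =>
    isBoundedUnder_of ⟨C, fun x => hb x⟩
  by_cases hp : p ∈ S
  · -- at a puncture: the modification agrees near `p` with `update G₀ p (lim)`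
    have hkey := RiemannSurface.mdifferentiableAt_update_limUnder (hd p) (hbd p)
    refine hkey.congr_of_eventuallyEq ?_
    -- the other points of `S` stay away from `p`
    have hS' : ∀ᶠ x in 𝓝 p, x ∈ (S \ {p})ᶜ :=
      ((hS.subset sdiff_subset).isClosed.isOpen_compl.mem_nhds fun h => h.2 rfl)
    filter_upwards [hS'] with x hx
    by_cases hxp : x = p
    · subst hxp
      simp only [hp, if_true, update_self]
    · have hxS : x ∉ S := fun h => hx ⟨h, hxp⟩
      simp only [hxS, if_false, update_of_ne hxp]
  · -- off `S`: the modification agrees near `p` with `G₀`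
    refine (hG₀ p hp).congr_of_eventuallyEq ?_
    filter_upwards [hS.isClosed.isOpen_compl.mem_nhds hp] with x hx
    simp only [show x ∉ S from hx, if_false]

/-- ★ **Liouville's theorem on a Riemann surface of finite type**: on `X ≅ X̄ ∖ S` (`X̄` a compact connected
Riemann surface, `S` finite — `IsOfFiniteType X`), every bounded holomorphic function `g : X → ℂ` is
constant.  (Transport to `X̄ ∖ S`, extend over the punctures by the bounded removable-singularity theorem,
and use that holomorphic functions on the compact connected `X̄` are constant.)
[cite: FarkasKra1992, IV.4] [cite: Schlag2014, §4.3 (p. 129)] [cite: MochizukiAbsTopIII2015, Corollary 2.4 p.54] -/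
theorem exists_eq_const_of_isOfFiniteType_of_bounded {X : Type} [TopologicalSpace X] [ChartedSpace ℂ X]
    (hX : IsOfFiniteType X) {g : X → ℂ} (hg : MDifferentiable 𝓘(ℂ, ℂ) 𝓘(ℂ, ℂ) g)
    (hb : ∃ C : ℝ, ∀ x, ‖g x‖ ≤ C) : ∃ c : ℂ, ∀ x, g x = c := by
  classical
  obtain ⟨C, hC⟩ := hb
  obtain ⟨⟨Xc, S, e, hol, hol_symm⟩⟩ := hX
  -- the open complement `U = X̄ ∖ S` and the transported function `u = g ∘ e⁻¹ : U → ℂ`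
  let U : Opens Xc := ⟨((S : Set Xc))ᶜ, S.finite_toSet.isClosed.isOpen_compl⟩
  have hu : MDifferentiable 𝓘(ℂ, ℂ) 𝓘(ℂ, ℂ) (g ∘ e.symm) := hg.comp hol_symm
  -- extend by `0` across `S`
  let G₀ : Xc → ℂ := fun x => if hx : x ∈ ((S : Set Xc))ᶜ then g (e.symm ⟨x, hx⟩) else 0
  have hG₀U : ∀ y : U, G₀ (y : Xc) = g (e.symm y) := fun y => (dif_pos y.2).trans rfl
  have hG₀d : ∀ x ∉ (S : Set Xc), MDifferentiableAt 𝓘(ℂ, ℂ) 𝓘(ℂ, ℂ) G₀ x := by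
    intro x hx
    have h1 : MDifferentiableAt 𝓘(ℂ, ℂ) 𝓘(ℂ, ℂ) (fun y : U => G₀ y) ⟨x, hx⟩ := by
      have : (fun y : U => G₀ y) = g ∘ e.symm := funext hG₀U
      rw [this]
      exact hu ⟨x, hx⟩
    exact (mdifferentiableAt_subtype_iff (U := U) (f := G₀) (x := ⟨x, hx⟩)).mp h1
  have hG₀b : ∀ x, ‖G₀ x‖ ≤ max C 0 := fun x => by
    by_cases hx : x ∈ ((S : Set Xc))ᶜ
    · simp only [G₀, dif_pos hx]
      exact (hC _).trans (le_max_left _ _)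
    · simp only [G₀, dif_neg hx, norm_zero]
      exact le_max_right _ _
  -- removable singularities at the punctures, then compactness of `X̄`
  obtain ⟨G, hG, hGG₀⟩ :=
    exists_mdifferentiable_eqOn_compl_of_finite_of_bounded S.finite_toSet hG₀d hG₀b
  obtain ⟨c, hc⟩ := hG.exists_eq_const_of_compactSpace
  refine ⟨c, fun x => ?_⟩
  have hx : ((e x : U) : Xc) ∉ (S : Set Xc) := fun h => (e x).2 h
  calc g x = g (e.symm (e x)) := by rw [e.symm_apply_apply]
    _ = G₀ ((e x : U) : Xc) := (hG₀U (e x)).symm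
    _ = G ((e x : U) : Xc) := (hGG₀ _ hx).symm
    _ = c := congrFun hc _

/-- **No non-constant holomorphic map of a finite-type Riemann surface into a disc**: if `g : X → ℂ` is
holomorphic with `‖g x‖ < R` for all `x`, then `g` is constant. [cite: FarkasKra1992, IV.4]
[cite: MochizukiAbsTopIII2015, Corollary 2.4 p.54] -/
theorem apply_eq_apply_of_isOfFiniteType_of_norm_lt {X : Type} [TopologicalSpace X] [ChartedSpace ℂ X]
    (hX : IsOfFiniteType X) {g : X → ℂ} (hg : MDifferentiable 𝓘(ℂ, ℂ) 𝓘(ℂ, ℂ) g) {R : ℝ}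
    (hb : ∀ x, ‖g x‖ < R) (x y : X) : g x = g y := by
  obtain ⟨c, hc⟩ := exists_eq_const_of_isOfFiniteType_of_bounded hX hg ⟨R, fun x => (hb x).le⟩
  rw [hc x, hc y]

end Literature.AnabelianGeometry.AbsoluteAnabelian

end
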